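import Summits.CriticalPhenomena.SAWScalingLimit.Theses.SAWRenewalTightness
import Literature.Probability.RandomPlanarGeometry.ChordalCurveFamily
import Mathlib.Analysis.Convex.GaugeRescale

/-!
# `ConfinementPositivity` (stmt-CriticalPhenomena-17587) — negative knowledge, cusp series 1/4: the witness domains

Refuter crux-attack support file (cdisprove) for the crux
`Summit.CriticalPhenomena.SAWScalingLimit.Theses.SAWRenewalTightness.ConfinementPositivity`.
Goal of the series (`Cusp1Domains`, `Cusp2Lattice`, `Cusp3Walks`, `SocketsFalse`): the SOCKET
hypothesis `D ∩ (B(a,d) ∪ B(b,d)) ⊆ D'` of the crux is load-bearing — without it the statement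
is FALSE, by the CUSP witness

* `D' = {0 < x < 1, |y| < x²/16}` (outward cusp at the marked point `a = 0`),
* `D  = {0 < x < 1, -1 < y < x²/16}` (fat below the cusp), `D' ⊆ D`, common marked points
  `a = 0`, `b = 1`.

This file constructs the two domains as `DobrushinDomain`s (`exists_cuspPair`), with no new
definition (everything is packaged existentially, so that the file is a pure-theorem helper):

* `exists_dobrushinDomain_of_convex` — every bounded convex open planar set with two distinct
  frontier points is the carrier of a Dobrushin domain marked at those points (Mathlib's
  `exists_homeomorph_image_interior_closure_frontier_eq_unitBall` transports the unit disc; a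
  rotation of the disc puts the first mark at parameter `0`);
* `exists_cuspHomeomorph` — the cusp map `ψ(x + iy) = x + i y|y|`, a homeomorphism of `ℂ` fixing
  the real axis (second coordinate: the order isomorphism `s ↦ s|s|` of `ℝ`);
* `exists_cuspPair` — `D' = ψ(W')`, `D = ψ(W)` for the convex wedge `W' = {|y| < x/4, x < 1}` and
  the convex quadrilateral `W = {0 < x < 1, -1 < y < x/4}` marked at `0` and `1`
  (`MarkedDomain.map`).

Everything proved, standard axioms. [folklore]
-/

noncomputable section

namespace Summit.CriticalPhenomena.SAWScalingLimit.Theorems.ConfinementPositivity.Negative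

open Set Metric Filter Topology Complex
open scoped Pointwise
open Literature.Probability.RandomPlanarGeometry Literature.Probability.LatticeModels

/-! ### Convex planar sets as Dobrushin domains -/

/-- A unit complex number times the unit circle parameter: `u · e^{iθ}` lies on the unit circle.
[folklore] -/
theorem norm_mul_circleMap_eq_one {u : ℂ} (hu : ‖u‖ = 1) (θ : ℝ) : ‖u * circleMap 0 1 θ‖ = 1 := by
  simp [circleMap, hu]

/-- **Every bounded convex open planar set with two distinct frontier points is the carrier of a
Dobrushin domain marked at those two points** (in this order).  The boundary loop is the image
of the unit circle under a homeomorphism of the plane mapping the unit disc onto the set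
(Mathlib's gauge rescaling), precomposed with the rotation putting the first point at parameter
`0`. [folklore] -/
theorem exists_dobrushinDomain_of_convex {W : Set ℂ} (hWo : IsOpen W) (hWc : Convex ℝ W)
    (hWb : Bornology.IsBounded W) (hWne : W.Nonempty) {p₀ p₁ : ℂ} (hp₀ : p₀ ∈ frontier W)
    (hp₁ : p₁ ∈ frontier W) (hne : p₀ ≠ p₁) :
    ∃ D : DobrushinDomain, D.carrier = W ∧ D.pt 0 = p₀ ∧ D.pt 1 = p₁ := by
  obtain ⟨h, hint, -, hfr⟩ := exists_homeomorph_image_interior_closure_frontier_eq_unitBall hWc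
    (by rwa [hWo.interior_eq]) hWb
  rw [hWo.interior_eq] at hint
  -- the two frontier points on the circle
  set u₀ := h p₀ with hu₀def
  set u₁ := h p₁ with hu₁def
  have hu₀ : ‖u₀‖ = 1 := by
    have : u₀ ∈ sphere (0 : ℂ) 1 := hfr ▸ mem_image_of_mem h hp₀
    simpa using this
  have hu₁ : ‖u₁‖ = 1 := by
    have : u₁ ∈ sphere (0 : ℂ) 1 := hfr ▸ mem_image_of_mem h hp₁
    simpa using this
  have hu₀0 : u₀ ≠ 0 := fun h0 => by simp [h0] at hu₀
  have hu01 : u₀ ≠ u₁ := fun e => hne (h.injective e)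
  -- the angle of `u₁ / u₀`
  have hq : ‖u₁ / u₀‖ = 1 := by rw [norm_div, hu₀, hu₁, div_one]
  obtain ⟨θ, hθ⟩ := (Complex.norm_eq_one_iff _).1 hq
  set t₁ : ℝ := Int.fract (θ / (2 * Real.pi)) with ht₁def
  have ht₁mem : t₁ ∈ Ico (0 : ℝ) 1 := ⟨Int.fract_nonneg _, Int.fract_lt_one _⟩
  have hcirc : circleMap 0 1 (2 * Real.pi * t₁) = u₁ / u₀ := by
    rw [← hθ]
    have h2π : (2 * Real.pi * t₁ : ℝ) = θ - (⌊θ / (2 * Real.pi)⌋ : ℝ) * (2 * Real.pi) := by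
      rw [ht₁def, Int.fract]
      field_simp
    have hper : Complex.exp (↑(2 * Real.pi * t₁) * I) = Complex.exp (θ * I) := by
      rw [h2π]
      push_cast
      rw [sub_mul, Complex.exp_sub, show (⌊θ / (2 * Real.pi)⌋ : ℂ) * (2 * Real.pi) * I =
        (⌊θ / (2 * Real.pi)⌋ : ℤ) * (2 * Real.pi * I) by ring,
        Complex.exp_int_mul_two_pi_mul_I, div_one]
    simp only [circleMap, zero_add, ofReal_one, one_mul]
    exact hper
  have ht₁0 : t₁ ≠ 0 := by
    intro h0
    rw [h0, mul_zero] at hcirc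
    simp only [circleMap, zero_add, ofReal_one, one_mul, ofReal_zero, zero_mul,
      Complex.exp_zero] at hcirc
    exact hu01 (by field_simp at hcirc; rw [hcirc])
  have ht₁pos : 0 < t₁ := lt_of_le_of_ne ht₁mem.1 (Ne.symm ht₁0)
  -- the rotated and transported disc
  set R : ℂ ≃ₜ ℂ := Homeomorph.mulLeft₀ u₀ hu₀0 with hRdef
  set e : ℂ ≃ₜ ℂ := R.trans h.symm with hedef
  have hball : R '' ball (0 : ℂ) 1 = ball 0 1 := by
    have : R '' ball (0 : ℂ) 1 = u₀ • ball (0 : ℂ) 1 := by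
      ext z; simp [hRdef, Homeomorph.mulLeft₀, Set.mem_smul_set, eq_comm]
    rw [this, _root_.smul_ball hu₀0, smul_zero, hu₀, one_mul]
  have hcarrier : e '' ball (0 : ℂ) 1 = W := by
    have he : (e : ℂ → ℂ) = h.symm ∘ R := rfl
    rw [he, image_comp, hball, Homeomorph.image_symm, ← hint, h.preimage_image]
  let J : JordanDomain := JordanDomain.unitDisc.map e
  have hbd : ∀ t : ℝ, J.boundary t = e (circleMap 0 1 (2 * Real.pi * t)) := fun t => rfl
  refine ⟨⟨J, ![0, t₁], ?_, ?_⟩, hcarrier, ?_, ?_⟩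
  · refine Fin.strictMono_iff_lt_succ.2 fun k => ?_
    fin_cases k
    simpa using ht₁pos
  · intro k
    fin_cases k
    · simp
    · simpa using ht₁mem
  · show J.boundary ((![0, t₁] : Fin 2 → ℝ) 0) = p₀
    rw [hbd]
    simp only [Matrix.cons_val_zero, mul_zero]
    show h.symm (u₀ * circleMap 0 1 0) = p₀
    have hc0 : circleMap 0 1 (0 : ℝ) = 1 := by simp [circleMap]
    rw [hc0, mul_one, hu₀def, h.symm_apply_apply]
  · show J.boundary ((![0, t₁] : Fin 2 → ℝ) 1) = p₁
    rw [hbd]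
    simp only [Matrix.cons_val_one, Matrix.cons_val_fin_one]
    show h.symm (u₀ * circleMap 0 1 (2 * Real.pi * t₁)) = p₁
    rw [hcirc, mul_div_cancel₀ _ hu₀0, hu₁def, h.symm_apply_apply]

/-! ### The cusp homeomorphism -/

/-- `s ↦ s|s|` is strictly increasing on `ℝ`. [folklore] -/
theorem strictMono_mul_abs_self : StrictMono fun s : ℝ => s * |s| := by
  intro a b hab
  simp only
  rcases le_or_gt 0 a with ha | ha
  · have hb : 0 < b := ha.trans_lt hab
    rw [abs_of_nonneg ha, abs_of_pos hb]; nlinarith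
  · rcases le_or_gt 0 b with hb | hb
    · rw [abs_of_neg ha, abs_of_nonneg hb]; nlinarith
    · rw [abs_of_neg ha, abs_of_neg hb]; nlinarith

/-- `s ↦ s|s|` is onto `ℝ`. [folklore] -/
theorem surjective_mul_abs_self : Function.Surjective fun s : ℝ => s * |s| := by
  intro t
  rcases le_or_gt 0 t with ht | ht
  · exact ⟨Real.sqrt t, by simp [abs_of_nonneg (Real.sqrt_nonneg t), Real.mul_self_sqrt ht]⟩
  · refine ⟨-Real.sqrt (-t), ?_⟩
    simp only
    rw [abs_of_nonpos (neg_nonpos.2 (Real.sqrt_nonneg _)), neg_neg, neg_mul,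
      Real.mul_self_sqrt (by linarith), neg_neg]

/-- **The cusp map** `ψ(x + iy) = x + i y|y|` exists as a homeomorphism of `ℂ`: it fixes the real
axis and maps the wedge `{|y| < x/4}` onto the cusp `{|y| < x²/16}`. [folklore] -/
theorem exists_cuspHomeomorph :
    ∃ ψ : ℂ ≃ₜ ℂ, ∀ z : ℂ, (ψ z).re = z.re ∧ (ψ z).im = z.im * |z.im| := by
  let sq : ℝ ≃ₜ ℝ :=
    (strictMono_mul_abs_self.orderIsoOfSurjective _ surjective_mul_abs_self).toHomeomorph
  have hsq : ∀ s, sq s = s * |s| := fun s => by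
    simp [sq, StrictMono.coe_orderIsoOfSurjective]
  refine ⟨Complex.equivRealProdCLM.toHomeomorph.trans
    (((Homeomorph.refl ℝ).prodCongr sq).trans Complex.equivRealProdCLM.toHomeomorph.symm),
    fun z => ⟨by simp, by simp [hsq]⟩⟩

/-! ### The convex preimages `W' ⊆ W` -/

/-- The open wedge `W' = {|y| < x/4, x < 1}` is convex. [folklore] -/
theorem convex_wedge : Convex ℝ {z : ℂ | |z.im| < z.re / 4 ∧ z.re < 1} := by
  have h1 : Convex ℝ {z : ℂ | z.im - z.re / 4 < 0} :=
    convex_halfSpace_lt ⟨fun x y => by simp; ring, fun c x => by simp; ring⟩ 0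
  have h2 : Convex ℝ {z : ℂ | -z.im - z.re / 4 < 0} :=
    convex_halfSpace_lt ⟨fun x y => by simp; ring, fun c x => by simp; ring⟩ 0
  have h3 : Convex ℝ {z : ℂ | z.re < 1} := convex_halfSpace_re_lt 1
  have : {z : ℂ | |z.im| < z.re / 4 ∧ z.re < 1} =
      {z : ℂ | z.im - z.re / 4 < 0} ∩ {z : ℂ | -z.im - z.re / 4 < 0} ∩ {z : ℂ | z.re < 1} := by
    ext z; simp only [mem_setOf_eq, mem_inter_iff, abs_lt]; constructor
    · rintro ⟨⟨h1, h2⟩, h3⟩; exact ⟨⟨by linarith, by linarith⟩, h3⟩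
    · rintro ⟨⟨h1, h2⟩, h3⟩; exact ⟨⟨by linarith, by linarith⟩, h3⟩
  rw [this]
  exact (h1.inter h2).inter h3

/-- The open quadrilateral `W = {0 < x < 1, -1 < y < x/4}` is convex. [folklore] -/
theorem convex_quad : Convex ℝ {z : ℂ | 0 < z.re ∧ z.re < 1 ∧ -1 < z.im ∧ z.im < z.re / 4} := by
  have h1 : Convex ℝ {z : ℂ | 0 < z.re} := convex_halfSpace_re_gt 0
  have h2 : Convex ℝ {z : ℂ | z.re < 1} := convex_halfSpace_re_lt 1
  have h3 : Convex ℝ {z : ℂ | -1 < z.im} := convex_halfSpace_im_gt (-1)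
  have h4 : Convex ℝ {z : ℂ | z.im - z.re / 4 < 0} :=
    convex_halfSpace_lt ⟨fun x y => by simp; ring, fun c x => by simp; ring⟩ 0
  have : {z : ℂ | 0 < z.re ∧ z.re < 1 ∧ -1 < z.im ∧ z.im < z.re / 4} =
      {z : ℂ | 0 < z.re} ∩ {z : ℂ | z.re < 1} ∩ {z : ℂ | -1 < z.im} ∩ {z : ℂ | z.im - z.re / 4 < 0} := by
    ext z; simp only [mem_setOf_eq, mem_inter_iff, sub_neg]; tauto
  rw [this]
  exact ((h1.inter h2).inter h3).inter h4

/-- The wedge is open. [folklore] -/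
theorem isOpen_wedge : IsOpen {z : ℂ | |z.im| < z.re / 4 ∧ z.re < 1} :=
  (isOpen_lt (continuous_abs.comp continuous_im) (continuous_re.div_const _)).inter
    (isOpen_lt continuous_re continuous_const)

/-- The quadrilateral is open. [folklore] -/
theorem isOpen_quad : IsOpen {z : ℂ | 0 < z.re ∧ z.re < 1 ∧ -1 < z.im ∧ z.im < z.re / 4} :=
  (isOpen_lt continuous_const continuous_re).inter <|
    (isOpen_lt continuous_re continuous_const).inter <|
      (isOpen_lt continuous_const continuous_im).inter
        (isOpen_lt continuous_im (continuous_re.div_const _))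

/-- The wedge lies in the quadrilateral. [folklore] -/
theorem wedge_subset_quad : {z : ℂ | |z.im| < z.re / 4 ∧ z.re < 1} ⊆
    {z : ℂ | 0 < z.re ∧ z.re < 1 ∧ -1 < z.im ∧ z.im < z.re / 4} := by
  rintro z ⟨h1, h2⟩
  obtain ⟨h3, h4⟩ := abs_lt.1 h1
  have := abs_nonneg z.im
  exact ⟨by linarith, h2, by linarith, h4⟩

/-- The quadrilateral lies in the ball of radius `2` (so both sets are bounded). [folklore] -/
theorem quad_subset_ball : {z : ℂ | 0 < z.re ∧ z.re < 1 ∧ -1 < z.im ∧ z.im < z.re / 4} ⊆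
    ball (0 : ℂ) 2 := by
  rintro z ⟨h1, h2, h3, h4⟩
  rw [mem_ball_zero_iff]
  refine (Complex.norm_le_abs_re_add_abs_im z).trans_lt ?_
  have hre : |z.re| < 1 := abs_lt.2 ⟨by linarith, by linarith⟩
  have him : |z.im| < 1 := abs_lt.2 ⟨by linarith, by linarith⟩
  linarith

/-- A real point `x ∈ (0, 1)` lies in the wedge. [folklore] -/
theorem ofReal_mem_wedge {x : ℝ} (hx : 0 < x) (hx1 : x < 1) :
    (x : ℂ) ∈ {z : ℂ | |z.im| < z.re / 4 ∧ z.re < 1} := by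
  refine ⟨?_, by simpa using hx1⟩
  simp only [ofReal_im, abs_zero, ofReal_re]
  linarith

/-- `0` and `1` lie in the closure of the wedge (limits of real points of `(0, 1)`). [folklore] -/
theorem zero_one_mem_closure_wedge :
    (0 : ℂ) ∈ closure {z : ℂ | |z.im| < z.re / 4 ∧ z.re < 1} ∧
      (1 : ℂ) ∈ closure {z : ℂ | |z.im| < z.re / 4 ∧ z.re < 1} := by
  constructor
  · rw [Metric.mem_closure_iff]
    intro ε hε
    refine ⟨(min (ε / 2) (1 / 2) : ℝ), ofReal_mem_wedge (by positivity)
      ((min_le_right _ _).trans_lt (by norm_num)), ?_⟩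
    rw [dist_comm, dist_zero_right, Complex.norm_real, Real.norm_eq_abs,
      abs_of_pos (by positivity)]
    exact (min_le_left _ _).trans_lt (by linarith)
  · rw [Metric.mem_closure_iff]
    intro ε hε
    refine ⟨((1 - min (ε / 2) (1 / 2) : ℝ) : ℂ), ofReal_mem_wedge
      (by have := min_le_right (ε / 2) (1 / 2 : ℝ); linarith)
      (by have : 0 < min (ε / 2) (1 / 2 : ℝ) := by positivity
          linarith), ?_⟩
    rw [Complex.dist_eq, show (1 : ℂ) - ((1 - min (ε / 2) (1 / 2) : ℝ) : ℂ) =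
      ((min (ε / 2) (1 / 2) : ℝ) : ℂ) by push_cast; ring, Complex.norm_real, Real.norm_eq_abs,
      abs_of_pos (by positivity)]
    exact (min_le_left _ _).trans_lt (by linarith)

/-- `0` and `1` are frontier points of the wedge and of the quadrilateral. [folklore] -/
theorem zero_one_mem_frontier :
    ((0 : ℂ) ∈ frontier {z : ℂ | |z.im| < z.re / 4 ∧ z.re < 1} ∧
      (1 : ℂ) ∈ frontier {z : ℂ | |z.im| < z.re / 4 ∧ z.re < 1}) ∧
    ((0 : ℂ) ∈ frontier {z : ℂ | 0 < z.re ∧ z.re < 1 ∧ -1 < z.im ∧ z.im < z.re / 4} ∧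
      (1 : ℂ) ∈ frontier {z : ℂ | 0 < z.re ∧ z.re < 1 ∧ -1 < z.im ∧ z.im < z.re / 4}) := by
  obtain ⟨h0, h1⟩ := zero_one_mem_closure_wedge
  have h0' := closure_mono wedge_subset_quad h0
  have h1' := closure_mono wedge_subset_quad h1
  rw [isOpen_wedge.frontier_eq, isOpen_quad.frontier_eq]
  refine ⟨⟨⟨h0, ?_⟩, ⟨h1, ?_⟩⟩, ⟨⟨h0', ?_⟩, ⟨h1', ?_⟩⟩⟩ <;> simp

/-! ### The cusp pair -/

/-- **The cusp pair.** There are Dobrushin domains `D' ⊆ D` with the SAME marked points `a = 0`,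
`b = 1` and carriers the cusp `D' = {0 < x < 1, |y| < x²/16}` and the region
`D = {0 < x < 1, -1 < y < x²/16}` (images of the wedge `W'` and the quadrilateral `W` under the
cusp homeomorphism `ψ`, which fixes `0` and `1`). Near `a` the boundaries of `D'` and `D` do NOT
agree: `D ∩ B(0, d) ⊄ D'` for every `d > 0` — the socket hypothesis of the crux fails, all the
others hold. [folklore] -/
theorem exists_cuspPair : ∃ D D' : DobrushinDomain,
    (∀ z : ℂ, z ∈ D'.carrier ↔ 0 < z.re ∧ z.re < 1 ∧ -(z.re ^ 2 / 16) < z.im ∧ z.im < z.re ^ 2 / 16) ∧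
    (∀ z : ℂ, z ∈ D.carrier ↔ 0 < z.re ∧ z.re < 1 ∧ -1 < z.im ∧ z.im < z.re ^ 2 / 16) ∧
    D'.carrier ⊆ D.carrier ∧ D'.pt 0 = D.pt 0 ∧ D'.pt 1 = D.pt 1 ∧ D'.pt 0 = 0 ∧ D'.pt 1 = 1 := by
  obtain ⟨⟨h0w, h1w⟩, ⟨h0q, h1q⟩⟩ := zero_one_mem_frontier
  obtain ⟨E', hE'c, hE'0, hE'1⟩ := exists_dobrushinDomain_of_convex isOpen_wedge convex_wedge
    ((isBounded_ball (x := (0 : ℂ)) (r := 2)).subset (wedge_subset_quad.trans quad_subset_ball))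
    ⟨_, ofReal_mem_wedge (by norm_num : (0 : ℝ) < 1 / 2) (by norm_num)⟩ h0w h1w zero_ne_one
  obtain ⟨E, hEc, hE0, hE1⟩ := exists_dobrushinDomain_of_convex isOpen_quad convex_quad
    ((isBounded_ball (x := (0 : ℂ)) (r := 2)).subset quad_subset_ball)
    ⟨_, wedge_subset_quad (ofReal_mem_wedge (by norm_num : (0 : ℝ) < 1 / 2) (by norm_num))⟩
    h0q h1q zero_ne_one
  obtain ⟨ψ, hψ⟩ := exists_cuspHomeomorph
  have hψ0 : ψ 0 = 0 := Complex.ext (by simp [(hψ 0).1]) (by simp [(hψ 0).2])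
  have hψ1 : ψ 1 = 1 := Complex.ext (by simp [(hψ 1).1]) (by simp [(hψ 1).2])
  -- images of the second coordinate: `y ↦ y|y|` maps `(-x/4, x/4)` onto `(-x²/16, x²/16)` and
  -- `(-1, x/4)` onto `(-1, x²/16)`
  have key₁ : ∀ (y x : ℝ), 0 < x → (|y| < x / 4 ↔ -(x ^ 2 / 16) < y * |y| ∧ y * |y| < x ^ 2 / 16) := by
    intro y x hx
    constructor
    · intro h
      obtain ⟨h1, h2⟩ := abs_lt.1 h
      rcases le_or_gt 0 y with hy | hy
      · rw [abs_of_nonneg hy]; constructor <;> nlinarith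
      · rw [abs_of_neg hy]; constructor <;> nlinarith
    · rintro ⟨h1, h2⟩
      rw [abs_lt]
      rcases le_or_gt 0 y with hy | hy
      · rw [abs_of_nonneg hy] at h1 h2; constructor <;> nlinarith
      · rw [abs_of_neg hy] at h1 h2; constructor <;> nlinarith
  have key₂ : ∀ (y : ℝ), (-1 < y ↔ -1 < y * |y|) := by
    intro y
    rcases le_or_gt 0 y with hy | hy
    · rw [abs_of_nonneg hy]; constructor <;> intro <;> nlinarith
    · rw [abs_of_neg hy]; constructor <;> intro <;> nlinarith
  have key₃ : ∀ (y x : ℝ), 0 < x → (y < x / 4 ↔ y * |y| < x ^ 2 / 16) := by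
    intro y x hx
    rcases le_or_gt 0 y with hy | hy
    · rw [abs_of_nonneg hy]; constructor <;> intro <;> nlinarith
    · rw [abs_of_neg hy]; constructor <;> intro <;> nlinarith
  refine ⟨E.map ψ, E'.map ψ, ?_, ?_, ?_, ?_, ?_, ?_, ?_⟩
  · intro z
    rw [MarkedDomain.carrier_map, hE'c, ← ψ.apply_symm_apply z, ψ.injective.mem_set_image]
    set w := ψ.symm z
    simp only [mem_setOf_eq, (hψ w).1, (hψ w).2]
    constructor
    · rintro ⟨h1, h2⟩
      have hx : 0 < w.re := by have := abs_nonneg w.im; linarith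
      exact ⟨hx, h2, (key₁ w.im w.re hx).1 h1⟩
    · rintro ⟨h1, h2, h3⟩
      exact ⟨(key₁ w.im w.re h1).2 h3, h2⟩
  · intro z
    rw [MarkedDomain.carrier_map, hEc, ← ψ.apply_symm_apply z, ψ.injective.mem_set_image]
    set w := ψ.symm z
    simp only [mem_setOf_eq, (hψ w).1, (hψ w).2]
    constructor
    · rintro ⟨h1, h2, h3, h4⟩
      exact ⟨h1, h2, (key₂ w.im).1 h3, (key₃ w.im w.re h1).1 h4⟩
    · rintro ⟨h1, h2, h3, h4⟩
      exact ⟨h1, h2, (key₂ w.im).2 h3, (key₃ w.im w.re h1).2 h4⟩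
  · rw [MarkedDomain.carrier_map, MarkedDomain.carrier_map, hE'c, hEc]
    exact image_mono wedge_subset_quad
  · rw [MarkedDomain.pt_map, MarkedDomain.pt_map, hE'0, hE0]
  · rw [MarkedDomain.pt_map, MarkedDomain.pt_map, hE'1, hE1]
  · rw [MarkedDomain.pt_map, hE'0, hψ0]
  · rw [MarkedDomain.pt_map, hE'1, hψ1]

end Summit.CriticalPhenomena.SAWScalingLimit.Theorems.ConfinementPositivity.Negative

end
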